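import Literature.Geometry.GaugeTheory.AsdConnectionFlatModel
import Literature.Geometry.GaugeTheory.BPSTInformationMetric
import Literature.Geometry.Riemannian.RoundSphere
import Mathlib.Analysis.Calculus.Deriv.Inv
import Mathlib.Analysis.Calculus.ContDiff.FiniteDimension
import HarnessLib

/-!
# The standard (BPST) instanton on `ℝ⁴` as an anti-self-dual connection on `P₁`, and its
# curvature density

Topic `Literature/Geometry/GaugeTheory`. The five-parameter family of **charge-one instantons on
flat `ℝ⁴`** with centre `a` and scale `λ > 0`,

  `A_{a,λ}(x) = Im( conj(x - a) dx ) / (λ² + |x - a|²)`   (`ℝ⁴ ≅ ℍ`, regular gauge),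

with curvature `F_{a,λ} = λ² dx̄ ∧ dx / (λ² + |x - a|²)²`, i.e.
`F_{a,λ}(x)(u, v) = 2λ²/(λ² + |x - a|²)² · Im(ū v)`, and pointwise norm
`|F_{a,λ}|²(x) = 48 λ⁴/(λ² + |x - a|²)⁴` (Naber 1997, Exercise 4.10.28 with (4.10.13), and §5.3,
Exercise 5.3.1, and §5.4 after (5.4.17): these field strengths are anti-self-dual) — realised
INSIDE the tree's
two-patch model of `AsdModuliSpace.lean`: over the base `X = ℝ⁴` (modelled on itself, standard
orientation `SmoothOrientation.euclidean 4`, Euclidean metric `euclideanMetric`) we construct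

* `BPST.connection a λ hλ p : SpOneConnection (SmoothOrientation.euclidean 4) 1 p` — the
  connection on the bundle `P₁` clutched at `p` whose ball-patch form is `A_{a,λ}` and whose
  punctured-patch form is its gauge transform `γ A γ⁻¹ - dγ γ⁻¹` by the clutching function
  `γ = (x - p)/|x - p|` (so that the gluing law `A₁ = γ⁻¹ A₀ γ + γ⁻¹ dγ` holds);
* `BPST.curvature_one` — its curvature is `F(x)(u,v) = 2λ²/(λ² + |x-a|²)² · Im(ū v)`;
* `BPST.isASD_connection` — it is anti-self-dual (`Im(ē₀e₁) + Im(ē₂e₃) = 0` &c. for the standard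
  frame `1, i, j, k`, and anti-self-duality is frame independent and gauge invariant:
  `AsdFrameIndependence.lean`, `AsdConnectionFlatModel.lean`), whence
  `BPST.instanton a λ hλ p : AsdConnection (euclideanMetric ℝ⁴) (SmoothOrientation.euclidean 4) 1 p`
  and the charge-one moduli space of flat `ℝ⁴` in the tree's model is non-empty;
* `BPST.curvatureDensity_connection` — its curvature density (`SpOneConnection.curvatureDensity`,
  the `ρ` of the information-metric and entropy files) is the tree's `bpstDensity a λ`:
  `ρ(x) = 48 λ⁴/(λ² + ‖x - a‖²)⁴`, the density whose Fisher–Rao form is computed exactly in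
  `BPSTInformationMetric.lean` (Groisser–Murray 1997, §3, p. 7, `|F_{0,λ}|² = 48λ⁴/(λ²+r²)⁴`).

The analytic input is elementary calculus on `ℝ⁴` (`AsdConnectionFlatModel.lean` turns the
chart-wise notions of the model into `fderiv`s); the algebraic heart is the quaternion identity
`BPST.curvature_algebra`.

## References

* G. L. Naber, *Topology, Geometry, and Gauge Fields: Foundations* (1997), §4.10,
  Exercise 4.10.28 and (4.10.13) (the potentials `A_{λ,n}` and their field strengths), §5.2,
  (5.2.4) (`F₂ = g₁₂⁻¹ F₁ g₁₂`), §5.3, Exercise 5.3.1 (`‖F_{λ,n}(q)‖²`, total field strength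
  `8π²`), §5.4, after (5.4.17) (the `F_{λ,n}` are anti-self-dual). [Naber1997]
* D. Groisser, M. K. Murray, *Instantons and the information metric*, Ann. Global Anal. Geom. 15
  (1997), §3, p. 7. [GroisserMurray1997]
* S. K. Donaldson, P. B. Kronheimer, *The Geometry of Four-Manifolds* (1990), §3.4 (the basic
  instanton). [DonaldsonKronheimer1990]
-/

noncomputable section

open scoped Manifold ContDiff Topology Quaternion RealInnerProductSpace
open Set Function Filter
open Literature.Geometry.Lorentzian (PseudoRiemannianMetric)
open Literature.Geometry.Riemannian (euclideanMetric euclideanMetric_apply frameOfFin)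
open Literature.Topology.FourManifolds

namespace Literature.Geometry.GaugeTheory

/-- Local notation: the model space `ℝ⁴`. -/
local notation "E4" => EuclideanSpace ℝ (Fin 4)

namespace BPST

/-! ### Quaternionic coordinates on `ℝ⁴` -/

/-- The quaternionic coordinate `ℝ⁴ ≅ ℍ`, `(x₀,x₁,x₂,x₃) ↦ x₀ + x₁ i + x₂ j + x₃ k` (the inverse of
Mathlib's `Quaternion.linearIsometryEquivTuple`); it is the tree's `orientedQuat` for the standard
orientation (`orientedQuat_euclidean`). [folklore] -/
abbrev toQuat : E4 ≃ₗᵢ[ℝ] ℍ := Quaternion.linearIsometryEquivTuple.symm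

/-- The quaternionic coordinate in components. [folklore] -/
theorem toQuat_apply (v : E4) : toQuat v = ⟨v 0, v 1, v 2, v 3⟩ := rfl

/-- For the standard orientation of `ℝ⁴` the oriented quaternionic coordinate of
`AsdModuliSpace.lean` is `toQuat`. [folklore] -/
theorem orientedQuat_euclidean (p v : E4) :
    orientedQuat (SmoothOrientation.euclidean 4) p v = toQuat v := by
  unfold orientedQuat
  rw [if_pos (SmoothOrientation.euclidean_apply 4 p)]

/-- The clutching function of `P₁` over flat `ℝ⁴` with the standard orientation:
`γ(x) = (x - p)/‖x - p‖` read in `ℍ`. [cite: Naber1997, §3.4] -/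
theorem clutchingFun_one_euclidean (p x : E4) :
    clutchingFun (SmoothOrientation.euclidean 4) 1 p x = (‖x - p‖⁻¹ : ℝ) • toQuat (x - p) := by
  rw [clutchingFun_apply_flat, orientedQuat_euclidean, zpow_one, LinearIsometryEquiv.norm_map]

/-- `|ξ|² = 2‖ξ‖² = 2 normSq ξ`. [folklore] -/
theorem adNormSq_eq_two_mul_normSq (ξ : ℍ) : adNormSq ξ = 2 * Quaternion.normSq ξ := by
  rw [adNormSq, sq, ← Quaternion.normSq_eq_norm_mul_self]

/-- The real part is a trace: `Re(a b) = Re(b a)`. [folklore] -/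
theorem re_mul_comm (a b : ℍ) : (a * b).re = (b * a).re := by
  simp only [Quaternion.re_mul]
  ring

/-- Conjugation by a non-zero quaternion preserves the real part. [folklore] -/
theorem re_conj {c : ℍ} (hc : c ≠ 0) (q : ℍ) : (c * q * c⁻¹).re = q.re := by
  rw [re_mul_comm, ← mul_assoc, inv_mul_cancel₀ hc, one_mul]

/-! ### The skew pairing `(w, v) ↦ Im(w̄ v)` and the potential -/

/-- The `ℍ`-valued pairing `ω(w, v) = Im( conj(w) v )` of two vectors of `ℝ⁴` (read in `ℍ`),
bilinear over `ℝ`; `ω(x - a, ·)` is the numerator of the BPST potential and `ω(u, v)` the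
quaternionic form of `½ dx̄ ∧ dx (u, v)`. [cite: Naber1997, §4.10 Exercise 4.10.28] -/
def pairing : E4 →ₗ[ℝ] E4 →ₗ[ℝ] ℍ :=
  LinearMap.mk₂ ℝ (fun w v ↦ (star (toQuat w) * toQuat v).im)
    (fun w w' v ↦ by simp only [map_add, star_add, add_mul, Quaternion.im_add])
    (fun c w v ↦ by
      simp only [LinearIsometryEquiv.map_smul, Quaternion.star_smul, smul_mul_assoc,
        Quaternion.im_smul])
    (fun w v v' ↦ by simp only [map_add, mul_add, Quaternion.im_add])
    (fun c w v ↦ by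
      simp only [LinearIsometryEquiv.map_smul, mul_smul_comm, Quaternion.im_smul])

/-- Unfolding `pairing`. [folklore] -/
@[simp] theorem pairing_apply (w v : E4) : pairing w v = (star (toQuat w) * toQuat v).im := rfl

/-- The scale factor `1/(λ² + ‖x - a‖²)` of the BPST potential. [cite: Naber1997, §4.10 Exercise 4.10.28] -/
def scale (a : E4) (l : ℝ) (x : E4) : ℝ := (l ^ 2 + ‖x - a‖ ^ 2)⁻¹

/-- Unfolding `scale`. [folklore] -/
theorem scale_apply (a : E4) (l : ℝ) (x : E4) : scale a l x = (l ^ 2 + ‖x - a‖ ^ 2)⁻¹ := rfl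

/-- The denominator of the scale factor is positive for `λ ≠ 0`. [folklore] -/
theorem scale_den_pos (a : E4) {l : ℝ} (hl : l ≠ 0) (x : E4) : 0 < l ^ 2 + ‖x - a‖ ^ 2 := by
  positivity

/-- The scale factor is positive for `λ ≠ 0`. [folklore] -/
theorem scale_pos (a : E4) {l : ℝ} (hl : l ≠ 0) (x : E4) : 0 < scale a l x :=
  inv_pos.2 (scale_den_pos a hl x)

/-- **The BPST potential with centre `a` and scale `λ` (regular gauge)** as a map
`ℝ⁴ → (ℝ⁴ →L[ℝ] ℍ)`: `A_{a,λ}(x)(v) = Im( conj(x - a) v ) / (λ² + |x - a|²)` (Naber 1997,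
Exercise 4.10.28: `A_{λ,n} = Im( (q̄ - n̄) dq / (|q - n|² + λ²) )`).
[cite: Naber1997, §4.10 Exercise 4.10.28] -/
def regularForm (a : E4) (l : ℝ) (x : E4) : E4 →L[ℝ] ℍ :=
  scale a l x • LinearMap.toContinuousLinearMap (pairing (x - a))

/-- The BPST potential as a local connection form on flat `ℝ⁴` (the ball-patch form of the BPST
connection; values in the tangent spaces `T_x ℝ⁴ = ℝ⁴`). [cite: Naber1997, §4.10 Exercise 4.10.28] -/
def potential (a : E4) (l : ℝ) : QuatOneForm E4 := fun x ↦ regularForm a l x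

/-- Unfolding `regularForm`. [folklore] -/
theorem regularForm_apply (a : E4) (l : ℝ) (x v : E4) :
    regularForm a l x v = scale a l x • (star (toQuat (x - a)) * toQuat v).im := rfl

/-- Unfolding `potential`. [folklore] -/
theorem potential_apply (a : E4) (l : ℝ) (x v : E4) :
    potential a l x v = scale a l x • (star (toQuat (x - a)) * toQuat v).im := rfl

/-- `potential` is `regularForm` read in the tangent spaces. [folklore] -/
theorem potential_eq_regularForm (a : E4) (l : ℝ) (x v : E4) :
    potential a l x v = regularForm a l x v := rfl

/-- The BPST potential takes values in `Im ℍ`. [folklore] -/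
theorem regularForm_re (a : E4) (l : ℝ) (x v : E4) : (regularForm a l x v).re = 0 := by
  rw [regularForm_apply, Quaternion.re_smul, Quaternion.re_im, smul_zero]

/-- The scale factor is `C^∞` (for `λ ≠ 0`). [folklore] -/
theorem contDiff_scale (a : E4) {l : ℝ} (hl : l ≠ 0) : ContDiff ℝ ∞ (scale a l) :=
  (contDiff_const.add ((contDiff_id.sub contDiff_const).norm_sq ℝ)).inv
    fun x ↦ (scale_den_pos a hl x).ne'

/-- Each component `x ↦ A(x)(w)` of the BPST potential is `C^∞` (for `λ ≠ 0`). [cite: Naber1997, §4.10 Exercise 4.10.28] -/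
theorem contDiff_regularForm_apply (a : E4) {l : ℝ} (hl : l ≠ 0) (w : E4) :
    ContDiff ℝ ∞ (fun x ↦ regularForm a l x w) := by
  have h1 : ContDiff ℝ ∞ (fun x : E4 ↦ pairing (x - a) w) :=
    (LinearMap.toContinuousLinearMap (pairing.flip w)).contDiff.comp
      (contDiff_id.sub contDiff_const)
  exact (contDiff_scale a hl).smul h1

/-- The BPST potential is `C^∞` on all of `ℝ⁴` as a map into `ℝ⁴ →L[ℝ] ℍ` (regular gauge;
`λ ≠ 0`; smoothness of a map into continuous linear maps on a finite-dimensional space is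
componentwise, `contDiff_clm_apply_iff`). [cite: Naber1997, §4.10 Exercise 4.10.28] -/
theorem contDiff_regularForm (a : E4) {l : ℝ} (hl : l ≠ 0) : ContDiff ℝ ∞ (regularForm a l) :=
  contDiff_clm_apply_iff.2 (contDiff_regularForm_apply a hl)

/-- **The derivative of the BPST potential**: for fixed `w`, the `ℍ`-valued function
`y ↦ A(y)(w)` has derivative `z ↦ s ω(z, w) - 2 s² ⟨x - a, z⟩ ω(x - a, w)` at `x`, with
`s = 1/(λ² + |x - a|²)`, `ω(w, v) = Im(w̄ v)`. [cite: Naber1997, §4.10 Exercise 4.10.28] -/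
theorem hasFDerivAt_regularForm_apply (a : E4) {l : ℝ} (hl : l ≠ 0) (x w : E4) :
    HasFDerivAt (fun y ↦ regularForm a l y w)
      (scale a l x • LinearMap.toContinuousLinearMap (pairing.flip w) -
        (scale a l x ^ 2 * 2) • (innerSL ℝ (x - a)).smulRight (pairing (x - a) w)) x := by
  have hc : HasFDerivAt (fun y : E4 ↦ l ^ 2 + ‖y - a‖ ^ 2)
      (2 • (innerSL ℝ (x - a)).comp (ContinuousLinearMap.id ℝ E4)) x :=
    ((hasFDerivAt_sub_const a).norm_sq).const_add (l ^ 2)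
  have hne : l ^ 2 + ‖x - a‖ ^ 2 ≠ 0 := (scale_den_pos a hl x).ne'
  have hs : HasFDerivAt (scale a l)
      ((ContinuousLinearMap.toSpanSingleton ℝ (-((l ^ 2 + ‖x - a‖ ^ 2) ^ 2)⁻¹)).comp
        (2 • (innerSL ℝ (x - a)).comp (ContinuousLinearMap.id ℝ E4))) x :=
    (hasFDerivAt_inv hne).comp x hc
  have hP : HasFDerivAt (fun y : E4 ↦ pairing (y - a) w)
      ((LinearMap.toContinuousLinearMap (pairing.flip w)).comp (ContinuousLinearMap.id ℝ E4)) x :=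
    (LinearMap.toContinuousLinearMap (pairing.flip w)).hasFDerivAt.comp x
      (hasFDerivAt_sub_const (x := x) a)
  refine (hs.smul hP).congr_fderiv ?_
  ext1 z
  simp only [_root_.add_apply, _root_.sub_apply, _root_.smul_apply,
    ContinuousLinearMap.smulRight_apply, ContinuousLinearMap.comp_apply,
    ContinuousLinearMap.id_apply, LinearMap.coe_toContinuousLinearMap', LinearMap.flip_apply,
    ContinuousLinearMap.toSpanSingleton_apply, innerSL_apply_apply, smul_eq_mul, nsmul_eq_mul,
    ← inv_pow, ← scale_apply]
  module

/-- The derivative of the BPST potential, `fderiv` form: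
`∂_z (A(·)(w))(x) = s ω(z, w) - 2 s² ⟨x - a, z⟩ ω(x - a, w)`. [cite: Naber1997, §4.10 Exercise 4.10.28] -/
theorem fderiv_regularForm_apply (a : E4) {l : ℝ} (hl : l ≠ 0) (x w z : E4) :
    fderiv ℝ (fun y ↦ regularForm a l y w) x z =
      scale a l x • (star (toQuat z) * toQuat w).im -
        (scale a l x ^ 2 * (2 * ⟪x - a, z⟫)) • (star (toQuat (x - a)) * toQuat w).im := by
  rw [(hasFDerivAt_regularForm_apply a hl x w).fderiv]
  simp only [_root_.sub_apply, _root_.smul_apply, ContinuousLinearMap.smulRight_apply,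
    LinearMap.coe_toContinuousLinearMap', LinearMap.flip_apply, innerSL_apply_apply,
    pairing_apply]
  module

/-- **The curvature identity behind the BPST instanton** (pure quaternion algebra): with
`ω(p, q) = Im(p̄ q)`, `⟨p, q⟩ = Re(p q̄)`, for all real `s` and `W, U, V ∈ ℍ`,
`[s ω(U,V) - 2s²⟨W,U⟩ ω(W,V)] - [s ω(V,U) - 2s²⟨W,V⟩ ω(W,U)] + s²[ω(W,U), ω(W,V)]
 = (2s - 2s²|W|²) ω(U, V)` — the left side is `dA + A ∧ A` for `A = s ω(W, ·)`,
`s = 1/(λ² + |W|²)`, `W = x - a`, and `2s - 2s²|W|² = 2λ²s²`. [cite: Naber1997, §4.10 (4.10.13)] -/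
theorem curvature_algebra (s : ℝ) (W U V : ℍ) :
    s • (star U * V).im - (s ^ 2 * (2 * (W * star U).re)) • (star W * V).im
      - (s • (star V * U).im - (s ^ 2 * (2 * (W * star V).re)) • (star W * U).im)
      + (s • (star W * U).im * (s • (star W * V).im) - s • (star W * V).im * (s • (star W * U).im))
      = (2 * s - 2 * s ^ 2 * Quaternion.normSq W) • (star U * V).im := by
  ext <;> simp [Quaternion.normSq_def'] <;> ring

/-- **The field strength of the BPST potential**: on the ball patch (all of `ℝ⁴`),
`F(x)(u, v) = dA(u,v) + [A(u), A(v)] = 2λ² s(x)² Im(ū v)`, `s = 1/(λ² + |x - a|²)`, i.e.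
`F = λ² dx̄ ∧ dx/(λ² + |x - a|²)²` (Naber 1997, Exercise 4.10.28). [cite: Naber1997, §4.10 Exercise 4.10.28] -/
theorem extDeriv_add_bracket_potential (a : E4) {l : ℝ} (hl : l ≠ 0) (x u v : E4) :
    (potential a l).extDeriv x u v +
        (potential a l x u * potential a l x v - potential a l x v * potential a l x u) =
      (2 * l ^ 2 * scale a l x ^ 2) • (star (toQuat u) * toQuat v).im := by
  have hdiff : DifferentiableAt (F := E4 →L[ℝ] ℍ) ℝ (potential a l) x :=
    (contDiff_regularForm a hl).contDiffAt.differentiableAt (by simp)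
  have hu : (fun y ↦ potential a l y u) = fun y ↦ regularForm a l y u := rfl
  have hv : (fun y ↦ potential a l y v) = fun y ↦ regularForm a l y v := rfl
  rw [(potential a l).extDeriv_eq_fderiv hdiff u v, hu, hv, fderiv_regularForm_apply a hl x v u,
    fderiv_regularForm_apply a hl x u v, potential_apply, potential_apply]
  set s := scale a l x with hs
  set W := toQuat (x - a) with hW
  set U := toQuat u with hU
  set V := toQuat v with hV
  have hsW : s * (l ^ 2 + Quaternion.normSq W) = 1 := by
    rw [hs, hW, scale_apply, Quaternion.normSq_eq_norm_mul_self, LinearIsometryEquiv.norm_map,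
      ← sq, inv_mul_cancel₀ (scale_den_pos a hl x).ne']
  have hipU : ⟪x - a, u⟫ = (W * star U).re := by
    rw [← Quaternion.inner_def, hW, hU, LinearIsometryEquiv.inner_map_map]
  have hipV : ⟪x - a, v⟫ = (W * star V).re := by
    rw [← Quaternion.inner_def, hW, hV, LinearIsometryEquiv.inner_map_map]
  have hcoef : 2 * l ^ 2 * s ^ 2 = 2 * s - 2 * s ^ 2 * Quaternion.normSq W := by
    linear_combination 2 * s * hsW
  rw [hipU, hipV, hcoef, ← curvature_algebra s W U V]

/-! ### The standard frame: orthonormal, positive, and `Im(ē_a e_b)` anti-self-dual -/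

/-- The standard basis of `ℝ⁴` is orthonormal for the Euclidean metric at every point. [folklore] -/
theorem isOrthonormalFrame_basisFun (x : E4) :
    (euclideanMetric E4).IsOrthonormalFrame x ⇑(EuclideanSpace.basisFun (Fin 4) ℝ) := by
  have h := orthonormal_iff_ite.1 (EuclideanSpace.basisFun (Fin 4) ℝ).orthonormal
  refine ⟨fun i ↦ ?_, fun i j hij ↦ ?_⟩
  · rw [euclideanMetric_apply]
    exact (h i i).trans (if_pos rfl)
  · rw [euclideanMetric_apply]
    exact (h i j).trans (if_neg hij)

/-- The standard basis of `ℝ⁴` is positively oriented for the standard orientation (by the very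
definition of `euclideanOrientation`). [folklore] -/
theorem isPosFrame_basisFun (x : E4) :
    (SmoothOrientation.euclidean 4).IsPosFrame x
      (⇑(EuclideanSpace.basisFun (Fin 4) ℝ) ∘ ⇑(finCongr finrank_euclideanSpace_fin)) := by
  set b : Module.Basis (Fin (Module.finrank ℝ E4)) ℝ E4 :=
    (EuclideanSpace.basisFun (Fin 4) ℝ).toBasis.reindex
      (finCongr (finrank_euclideanSpace_fin (𝕜 := ℝ) (n := 4)).symm) with hbdef
  have hb : ⇑b = ⇑(EuclideanSpace.basisFun (Fin 4) ℝ) ∘ ⇑(finCongr finrank_euclideanSpace_fin) := by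
    funext i
    simp only [hbdef, Module.Basis.reindex_apply, finCongr_symm, OrthonormalBasis.coe_toBasis,
      comp_apply]
  rw [← hb, (SmoothOrientation.euclidean 4).isPosFrame_iff_orientation_eq x b]
  rfl

/-- The standard basis is a positively oriented orthonormal frame for `(euclideanMetric, euclidean
orientation)` at every point of `ℝ⁴`. [folklore] -/
theorem isPosOrthonormalFrame_basisFun (x : E4) :
    IsPosOrthonormalFrame (euclideanMetric E4) (SmoothOrientation.euclidean 4) x
      ⇑(EuclideanSpace.basisFun (Fin 4) ℝ) :=
  ⟨isOrthonormalFrame_basisFun x, isPosFrame_basisFun x⟩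

/-- The standard basis vectors read in `ℍ`: `e₀ ↦ 1`, `e₁ ↦ i`, `e₂ ↦ j`, `e₃ ↦ k`. [folklore] -/
theorem toQuat_basisFun (i : Fin 4) :
    toQuat (EuclideanSpace.basisFun (Fin 4) ℝ i) =
      ⟨if i = 0 then 1 else 0, if i = 1 then 1 else 0, if i = 2 then 1 else 0,
        if i = 3 then 1 else 0⟩ := by
  rw [toQuat_apply, EuclideanSpace.basisFun_apply]
  ext <;> simp [eq_comm]

/-- **`Im(ē_a e_b)` is anti-self-dual in the standard frame**: `Im(1̄ i) + Im(j̄ k) = 0`,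
`Im(1̄ j) + Im(k̄ i) = 0`, `Im(1̄ k) + Im(ī j) = 0` — the quaternionic 2-form `dx̄ ∧ dx` is
anti-self-dual for the orientation `(1, i, j, k)` (Naber 1997, §5.4, after (5.4.17): the
2-forms `F_{λ,n} = λ² dq̄ ∧ dq/(|q-n|² + λ²)²` are ASD), in the tree's frame-wise convention
`IsASDIn`. [cite: Naber1997, §5.4 (5.4.17)] -/
theorem isASDIn_im_star_mul (c : ℝ) :
    IsASDIn (fun u v : E4 ↦ c • (star (toQuat u) * toQuat v).im)
      ⇑(EuclideanSpace.basisFun (Fin 4) ℝ) := by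
  unfold IsASDIn sdComponents
  simp only [toQuat_basisFun]
  funext i
  fin_cases i <;>
    · simp only [Fin.isValue, Fin.zero_eta, Fin.mk_one, Fin.reduceFinMk, Matrix.cons_val_zero,
        Matrix.cons_val_one, Matrix.cons_val, Pi.zero_apply, ← smul_add, smul_eq_zero]
      right
      ext <;> simp

/-- The six values `normSq (Im(ē_a e_b)) = 1`, `a < b`, for the standard frame (each `ē_a e_b` is a
unit imaginary quaternion). [folklore] -/
theorem normSq_im_star_mul_basisFun :
    Quaternion.normSq (star (toQuat (EuclideanSpace.basisFun (Fin 4) ℝ 0)) *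
        toQuat (EuclideanSpace.basisFun (Fin 4) ℝ 1)).im = 1 ∧
    Quaternion.normSq (star (toQuat (EuclideanSpace.basisFun (Fin 4) ℝ 0)) *
        toQuat (EuclideanSpace.basisFun (Fin 4) ℝ 2)).im = 1 ∧
    Quaternion.normSq (star (toQuat (EuclideanSpace.basisFun (Fin 4) ℝ 0)) *
        toQuat (EuclideanSpace.basisFun (Fin 4) ℝ 3)).im = 1 ∧
    Quaternion.normSq (star (toQuat (EuclideanSpace.basisFun (Fin 4) ℝ 1)) *
        toQuat (EuclideanSpace.basisFun (Fin 4) ℝ 2)).im = 1 ∧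
    Quaternion.normSq (star (toQuat (EuclideanSpace.basisFun (Fin 4) ℝ 1)) *
        toQuat (EuclideanSpace.basisFun (Fin 4) ℝ 3)).im = 1 ∧
    Quaternion.normSq (star (toQuat (EuclideanSpace.basisFun (Fin 4) ℝ 2)) *
        toQuat (EuclideanSpace.basisFun (Fin 4) ℝ 3)).im = 1 := by
  simp only [toQuat_basisFun]
  refine ⟨?_, ?_, ?_, ?_, ?_, ?_⟩ <;> simp [Quaternion.normSq_def']

/-! ### The connection on `P₁` -/

section Connection

variable (a : E4) (l : ℝ) (p : E4)

/-- Abbreviation inside this section: the clutching function `γ = (x - p)/|x - p|` of `P₁` over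
flat `ℝ⁴` with the standard orientation. -/
local notation "γ" => clutchingFun (SmoothOrientation.euclidean 4) 1 p

/-- **The punctured-patch form of the BPST connection on `P₁`** as a map
`ℝ⁴ → (ℝ⁴ →L[ℝ] ℍ)`: the gauge transform `A₀ = γ A γ⁻¹ - dγ γ⁻¹` of the regular-gauge potential
`A = A_{a,λ}` by the clutching function `γ` — forced by the gluing law `A₁ = γ⁻¹ A₀ γ + γ⁻¹ dγ` of
the two-patch model (Labastida–Mariño 2005, (2.1), (2.4); Naber 1997, (4.8.23), (5.2.4)). Written
with continuous linear maps so that its smoothness off `p` is manifest. [cite: Naber1997, §5.2 (5.2.4)] -/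
def singularCLM (x : E4) : E4 →L[ℝ] ℍ :=
  ((ContinuousLinearMap.mul ℝ ℍ).flip (γ x)⁻¹ ∘L ContinuousLinearMap.mul ℝ ℍ (γ x)) ∘L
      regularForm a l x -
    (ContinuousLinearMap.mul ℝ ℍ).flip (γ x)⁻¹ ∘L fderiv ℝ γ x

/-- The punctured-patch form as a local connection form (values in the tangent spaces).
[cite: Naber1997, §5.2 (5.2.4)] -/
def singularForm : QuatOneForm E4 := fun x ↦ singularCLM a l p x

/-- Unfolding `singularForm`: `A₀(x)(v) = γ A(x)(v) γ⁻¹ - dγ(x)(v) γ⁻¹`. [folklore] -/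
theorem singularForm_apply (x v : E4) :
    singularForm a l p x v =
      γ x * regularForm a l x v * (γ x)⁻¹ - fderiv ℝ γ x v * (γ x)⁻¹ := by
  show singularCLM a l p x v = _
  simp only [singularCLM, _root_.sub_apply, ContinuousLinearMap.comp_apply,
    ContinuousLinearMap.flip_apply, ContinuousLinearMap.mul_apply']

variable {p} in
/-- **`Re(dγ(v) γ⁻¹) = 0` for the unit-quaternion-valued clutching function**: `‖γ‖ ≡ 1` near
`x ≠ p`, so `0 = ∂_v ‖γ‖² = 2⟨γ, dγ(v)⟩ = 2 Re(dγ(v) γ̄)` and `γ⁻¹ = γ̄`. [folklore] -/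
theorem re_fderiv_clutchingFun_mul_inv {x : E4} (hx : x ≠ p) (v : E4) :
    (fderiv ℝ γ x v * (γ x)⁻¹).re = 0 := by
  have hmem : ∀ {y : E4}, y ≠ p → y ∈ patch p 0 ∩ patch p 1 := fun hy ↦
    ⟨mem_patch_zero_iff.2 hy, by rw [patch_one_eq_univ]; exact mem_univ _⟩
  have hγd : DifferentiableAt ℝ γ x :=
    (contDiffAt_clutchingFun (SmoothOrientation.euclidean 4) 1 hx).differentiableAt (by simp)
  -- `‖γ‖² ≡ 1` near `x`, hence its derivative `2⟨γ x, dγ ·⟩` vanishes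
  have h1 : HasFDerivAt (fun y ↦ ‖γ y‖ ^ 2) (2 • (innerSL ℝ (γ x)).comp (fderiv ℝ γ x)) x :=
    hγd.hasFDerivAt.norm_sq
  have h2 : HasFDerivAt (fun y ↦ ‖γ y‖ ^ 2) (0 : E4 →L[ℝ] ℝ) x := by
    refine (hasFDerivAt_const (1 : ℝ) x).congr_of_eventuallyEq ?_
    filter_upwards [isOpen_compl_singleton.mem_nhds hx] with y hy
    rw [norm_clutchingFun _ (hmem hy), one_pow]
  have h3 := DFunLike.congr_fun (h1.unique h2) v
  simp only [_root_.smul_apply, ContinuousLinearMap.comp_apply, innerSL_apply_apply,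
    _root_.zero_apply, smul_eq_zero, OfNat.ofNat_ne_zero, false_or] at h3
  -- `γ⁻¹ = γ̄` and `Re(dγ(v) γ̄) = ⟨dγ(v), γ⟩ = ⟨γ, dγ(v)⟩ = 0`
  have hn : ‖γ x‖ = 1 := norm_clutchingFun _ (hmem hx)
  have hinv : (γ x)⁻¹ = star (γ x) := by
    rw [Quaternion.inv_def, Quaternion.normSq_eq_norm_mul_self, hn, mul_one, inv_one, one_smul]
  rw [hinv, ← Quaternion.inner_def, real_inner_comm]
  exact h3

variable {l} in
/-- **The BPST connection with centre `a` and scale `λ ≠ 0` on the bundle `P₁ → ℝ⁴` clutched at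
`p`** (standard orientation), in the two-patch model of `AsdModuliSpace.lean`: ball-patch form the
regular-gauge potential `A_{a,λ} = Im( conj(x-a) dx )/(λ² + |x-a|²)` (Naber 1997, Exercise
4.10.28), punctured-patch form its gauge transform by the clutching function (`singularForm`); both
are `Im ℍ`-valued and smooth on their patches and satisfy the gluing law `A₁ = γ⁻¹ A₀ γ + γ⁻¹ dγ`.
[cite: Naber1997, §4.10 Exercise 4.10.28] -/
def connection (hl : l ≠ 0) : SpOneConnection (SmoothOrientation.euclidean 4) 1 p where
  form := ![singularForm a l p, potential a l]
  re_eq_zero i x hx v := by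
    fin_cases i
    · have hxp : x ≠ p := mem_patch_zero_iff.1 hx
      have h0 : γ x ≠ 0 :=
        clutchingFun_ne_zero _ ⟨hx, by rw [patch_one_eq_univ]; exact mem_univ x⟩
      show (singularForm a l p x v).re = 0
      rw [singularForm_apply, Quaternion.re_sub, re_conj h0, regularForm_re,
        re_fderiv_clutchingFun_mul_inv hxp, sub_zero]
    · exact regularForm_re a l x v
  smoothAt i x hx := by
    fin_cases i
    · have hxp : x ≠ p := mem_patch_zero_iff.1 hx
      have hγ : ContDiffAt ℝ ∞ γ x := contDiffAt_clutchingFun (SmoothOrientation.euclidean 4) 1 hxp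
      have h0 : γ x ≠ 0 :=
        clutchingFun_ne_zero _ ⟨hx, by rw [patch_one_eq_univ]; exact mem_univ x⟩
      have hinv : ContDiffAt ℝ ∞ (fun y ↦ (γ y)⁻¹) x := by
        have hi : ContDiffAt ℝ ∞ (Inv.inv : ℍ → ℍ) (γ x) := by
          rw [← Ring.inverse_eq_inv']
          exact contDiffAt_ringInverse (𝕜 := ℝ) (Units.mk0 _ h0)
        exact hi.comp x hγ
      have hR : ContDiffAt ℝ ∞ (fun y ↦ (ContinuousLinearMap.mul ℝ ℍ).flip (γ y)⁻¹) x :=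
        (ContinuousLinearMap.mul ℝ ℍ).flip.contDiff.contDiffAt.comp x hinv
      have hL : ContDiffAt ℝ ∞ (fun y ↦ ContinuousLinearMap.mul ℝ ℍ (γ y)) x :=
        (ContinuousLinearMap.mul ℝ ℍ).contDiff.contDiffAt.comp x hγ
      have hA : ContDiffAt ℝ ∞ (regularForm a l) x := (contDiff_regularForm a hl).contDiffAt
      have hD : ContDiffAt ℝ ∞ (fderiv ℝ γ) x := hγ.fderiv_right (by simp)
      show (singularForm a l p).SmoothAt x
      rw [QuatOneForm.smoothAt_iff_contDiffAt]
      exact ((hR.clm_comp hL).clm_comp hA).sub (hR.clm_comp hD)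
    · show (potential a l).SmoothAt x
      rw [QuatOneForm.smoothAt_iff_contDiffAt]
      exact (contDiff_regularForm a hl).contDiffAt
  compat x hx v := by
    have h0 : γ x ≠ 0 := clutchingFun_ne_zero _ hx
    show regularForm a l x v = (γ x)⁻¹ * singularForm a l p x v * γ x + (γ x)⁻¹ * quatDeriv γ x v
    rw [quatDeriv_eq_fderiv, singularForm_apply, mul_sub, sub_mul]
    simp only [mul_assoc, inv_mul_cancel₀ h0, mul_one, inv_mul_cancel_left₀ h0]
    exact (sub_add_cancel _ _).symm

variable {l} (hl : l ≠ 0)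

/-- The ball-patch form of the BPST connection is the regular-gauge potential. [folklore] -/
@[simp] theorem connection_form_one : (connection a p hl).form 1 = potential a l := rfl

/-- The punctured-patch form of the BPST connection is the gauge-transformed potential. [folklore] -/
@[simp] theorem connection_form_zero : (connection a p hl).form 0 = singularForm a l p := rfl

/-- **The curvature of the BPST connection** on the ball patch:
`F₁(x)(u, v) = 2λ²/(λ² + |x - a|²)² · Im(ū v)` (Naber 1997, Exercise 4.10.28:
`F_{λ,n} = λ² dq̄ ∧ dq/(|q - n|² + λ²)²`). [cite: Naber1997, §4.10 Exercise 4.10.28] -/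
theorem curvature_one (x u v : E4) :
    (connection a p hl).curvature 1 x u v =
      (2 * l ^ 2 * scale a l x ^ 2) • (star (toQuat u) * toQuat v).im := by
  rw [SpOneConnection.curvature, connection_form_one]
  exact extDeriv_add_bracket_potential a hl x u v

/-- **The BPST connection is anti-self-dual** for the Euclidean metric and the standard
orientation of `ℝ⁴` (Naber 1997, §5.4, after (5.4.17): "all of the `Im ℍ`-valued 2-forms
`F_{λ,n} = λ² dq̄ ∧ dq/(|q - n|² + λ²)²` … are ASD. These are … the gauge field strengths for the
generic BPST gauge potentials `A_{λ,n}`"; here: `F₁` is a real multiple of `Im(ū v)`, anti-self-dual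
in the standard frame, hence in every positive orthonormal frame, and `F₀ = γ F₁ γ⁻¹`).
[cite: Naber1997, §5.4 (5.4.17)] -/
theorem isASD_connection :
    (connection a p hl).IsASD (euclideanMetric E4) := by
  rw [SpOneConnection.isASD_iff_patch_one]
  intro x e he
  have hstd : IsASDIn ((connection a p hl).curvature 1 x) ⇑(EuclideanSpace.basisFun (Fin 4) ℝ) := by
    have hF : (connection a p hl).curvature 1 x =
        fun u v : E4 ↦ (2 * l ^ 2 * scale a l x ^ 2) • (star (toQuat u) * toQuat v).im := by
      funext u v
      exact curvature_one a p hl x u v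
    rw [hF]
    exact isASDIn_im_star_mul _
  exact IsASDIn.of_isPosOrthonormalFrame (euclideanMetric E4) (SmoothOrientation.euclidean 4)
    ((connection a p hl).curvature_add_left 1 x) ((connection a p hl).curvature_smul_left 1 x)
    (fun u v ↦ (connection a p hl).curvature_swap 1 x v u) (isPosOrthonormalFrame_basisFun x) he
    hstd

/-- **The BPST instanton**: the BPST connection as a point of the space of anti-self-dual
connections on `P₁ → ℝ⁴` (Euclidean metric, standard orientation). [cite: Naber1997, §5.4 (5.4.17)] -/
def instanton : AsdConnection (euclideanMetric E4) (SmoothOrientation.euclidean 4) 1 p :=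
  ⟨connection a p hl, isASD_connection a p hl⟩

/-- **The curvature density of the BPST connection is the BPST density**
`ρ(x) = |F|²(x) = 48 λ⁴/(λ² + ‖x - a‖²)⁴` (`bpstDensity a λ` of `BPSTInformationMetric.lean`;
Naber 1997, Exercise 5.3.1; Groisser–Murray 1997, p. 7): in the standard frame the six values
`|F(e_a, e_b)|² = 2 ‖2λ²s² Im(ē_a e_b)‖² = 8 λ⁴ s⁴` add up to `48 λ⁴ s⁴`, `s = 1/(λ² + ‖x-a‖²)`.
[cite: Naber1997, §5.3 Exercise 5.3.1] -/
theorem curvatureDensity_connection (x : E4) :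
    (connection a p hl).curvatureDensity (euclideanMetric E4) x = bpstDensity a l x := by
  rw [(connection a p hl).curvatureDensity_eq_twoFormNormSq (euclideanMetric E4) (i := 1)
      (by rw [patch_one_eq_univ]; exact mem_univ x),
    twoFormNormSq_eq_six_of_isOrthonormalFrame (euclideanMetric E4)
      ((connection a p hl).curvature_add_left 1 x) ((connection a p hl).curvature_smul_left 1 x)
      (fun u v ↦ (connection a p hl).curvature_swap 1 x v u) (isOrthonormalFrame_basisFun x)]
  simp only [curvature_one, adNormSq_eq_two_mul_normSq, Quaternion.normSq_smul]
  obtain ⟨h01, h02, h03, h12, h13, h23⟩ := normSq_im_star_mul_basisFun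
  rw [h01, h02, h03, h12, h13, h23, bpstDensity_apply, scale_apply]
  have hne : l ^ 2 + ‖x - a‖ ^ 2 ≠ 0 := (scale_den_pos a hl x).ne'
  field_simp
  ring

end Connection

/-- **The charge-one moduli space of flat `ℝ⁴` is non-empty** in the tree's model: the class of
the BPST instanton (any centre and scale, clutched at the base point). [cite: Naber1997, §5.3 Exercise 5.3.1] -/
instance instNonemptyAsdModuliSpaceOne :
    Nonempty (AsdModuliSpace (euclideanMetric E4) (SmoothOrientation.euclidean 4) 1) :=
  ⟨AsdModuliSpace.mk (instanton 0 (basePoint E4) one_ne_zero)⟩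

end BPST

end Literature.Geometry.GaugeTheory

end
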